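import Literature.NumberTheory.EllipticCurves.CanonicalPAdicHeightCycGaloisProofs
import Literature.NumberTheory.EllipticCurves.FormalGroupChartLevel
import Literature.NumberTheory.EllipticCurves.FormalGroupChartLimitLogProofs
import Literature.NumberTheory.NumberFields.PrimesAbovePEmbeddingNormProofs
import Mathlib.NumberTheory.Padics.Complex
import HarnessLib

/-!
# The canonical cyclotomic `p`-adic height over a number field `H`, ANY prime `p`: the admissible
# locus lies in an `Aut(H/ℚ)`-stable subgroup of `E(H)` contracting onto a torsion-free core (proofs only)

Trunk T-NT-EC (`Literature/NumberTheory/EllipticCurves`). Pure proof file (no definitions, no named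
facts). First file of the programme proving the named fact `WeierstrassCurve.exists_isCanonicalCyc`
(`CanonicalPAdicHeightCyc.lean`: existence of THE canonical cyclotomic `p`-adic height datum on `E(H)`,
`H` a number field with ANY splitting behaviour of `p`) at EVERY prime `p`, generalising the `p = 2`
file `CanonicalPAdicHeightCycLocusTwoProofs.lean` (there: one subgroup, read at the primes `w ∋ 2`
through the `2`-rescaled model). Here the `p`-adic conditions are read at the EMBEDDINGS
`σ : H → ℂ_p`: for each `σ` the pull-back `w_σ = ‖σ ·‖` of the norm of `ℂ_p` is an `ℝ≥0`-valued
valuation of `H` for which `W ⊗ H` is integral, so the power-series-free chart calculus of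
`FormalGroupChart.lean` / `FormalGroupChartLimitLogProofs.lean` (the kernel of reduction `E₁` as a
subgroup, `|z(P + Q)| ≤ max(|z(P)|, |z(Q)|)`, `|z(n·Q) − n z(Q)| ≤ |z(Q)|²`) applies to the points of
`E(H)` themselves — no completion `H_w`, no power series, no sharp `p`-torsion bound.

TWO SUBGROUPS. For `W/ℚ` with integer coefficients, a prime `p` and a number field `H`:

* the DISC subgroup `A`: affine points `(x, y)` with `‖σ x‖ > 1` and `‖σ z‖^{p−1} < ‖p‖` (`z = −x/y`,
  the sigma disc `ord_p z > 1/(p−1)`) under EVERY embedding `σ : H → ℂ_p`, and non-singular reduction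
  at every finite place; it CONTAINS every point satisfying `SatisfiesLocalConditionsCyc p`
  (place-wise conditions `ord_w x < 0`, `ord_w(z^{p−1}) > ord_w p` at all `w ∋ p` ⇒ embedding-wise
  conditions, by the one-way bridge of `PrimesAbovePEmbeddingNormProofs.lean`) and is
  `Aut(H/ℚ)`-stable (`σ ↦ σ ∘ τ` permutes the embeddings; the places are permuted);
* the CORE `G ≤ A`: the same with the STRICT first-order disc `‖σ z‖ < ‖p‖`; it is TORSION-FREE by
  the first-order estimate alone (a point of prime order `q` in `E₁` has `‖q‖ ≤ ‖z‖`: for `q = p`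
  this contradicts `‖z‖ < ‖p‖`, for `q ≠ p` it contradicts `‖z‖ < 1 = ‖q‖`), and every point of `A`
  has a `p`-power multiple in `G` (`‖z(p·Q)‖ ≤ ‖z(Q)‖ · max(‖p‖, ‖z(Q)‖)`).

The sharp statement «`A` itself is torsion-free» (true: `p`-torsion has `ord_p z ≤ 1/(p−1)`) is
NOT needed by the existence proof (`CanonicalPAdicHeightCycExistenceProofs.lean`: Jordan–von Neumann
on `G`, then `q(nP) = n² q(P)` along the torsion-free cyclic group generated by an admissible `P`).

PROVED: `exists_addSubgroup_strictLevelPow` (generic valued field: the strict power-level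
`{P ∈ E₁ : |z(P)|ⁿ < t}` is a subgroup), `val_le_val_zCoord_of_smul_eq_zero` (first-order torsion
estimate), `val_zCoord_pow_smul_le_mul_pow` (contraction), `isIntegral_integer_valuationComap`,
`exists_addSubgroups_embDisc` (one embedding), and the main theorem `exists_addSubgroups_cycLocus`.

## Sources

* J. H. Silverman, *The Arithmetic of Elliptic Curves*, 2nd ed. (2009): IV.1, Prop. IV.2.3, IV.3.2,
  VII.2.1–2.2, VII.3.1 (torsion in `E₁`).
* B. Mazur, W. Stein, J. Tate, Doc. Math. Extra Vol. Coates (2006), §2.6–2.7 (admissible points).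
* W. Stein, C. Wuthrich, Math. Comp. 82 (2013), §4 (sigma disc `ord_p z > 1/(p−1)`).
* J. Neukirch, *Algebraic Number Theory* (1999), Ch. II (8.1)–(8.2) (embeddings and primes above `p`).
-/

noncomputable section

open scoped Classical NNReal
open IsDedekindDomain NumberField

namespace Literature.NumberTheory.EllipticCurves

/-! ### Generic valued field: strict power-levels, first-order torsion estimate, contraction -/

section Generic

open FormalGroupChart

variable {F : Type*} [Field F] {w : Valuation F ℝ≥0} {V : WeierstrassCurve F}
  [hV : V.IsIntegral w.integer]

variable (w V) in
/-- **The strict power-level `{P ∈ E₁ : |z(P)|ⁿ < t}` is a subgroup** of the points of a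
`w`-integral Weierstrass equation over a valued field (`n ≠ 0`), because `|z(P + Q)| ≤
max(|z(P)|, |z(Q)|)` and `|z(−P)| = |z(P)|` on `E₁` (`val_zCoord_add_le`, `val_zCoord_neg`).
With `n = p − 1`, `t = |p|` this is the sigma disc; with `n = 1` the first-order disc.
[cite: SilvermanAEC2009, Prop. IV.3.2(a) with Prop. VII.2.2] -/
theorem exists_addSubgroup_strictLevelPow {n : ℕ} (hn : n ≠ 0) {t : ℝ≥0} (ht : 0 < t) :
    ∃ S : AddSubgroup V.toAffine.Point,
      ∀ P, P ∈ S ↔ P ∈ kernel w V ∧ w P.zCoord ^ n < t := by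
  refine ⟨{ carrier := {P | P ∈ kernel w V ∧ w P.zCoord ^ n < t}
            zero_mem' := ⟨(kernel w V).zero_mem, by
              rw [WeierstrassCurve.Affine.Point.zCoord_zero, map_zero, zero_pow hn]; exact ht⟩
            add_mem' := fun {P Q} hP hQ => ⟨(kernel w V).add_mem hP.1 hQ.1, ?_⟩
            neg_mem' := fun {P} hP => ⟨(kernel w V).neg_mem hP.1, by
              rw [val_zCoord_neg hP.1]; exact hP.2⟩ }, fun P => Iff.rfl⟩
  calc w (P + Q).zCoord ^ n ≤ (max (w P.zCoord) (w Q.zCoord)) ^ n :=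
        pow_le_pow_left₀ zero_le (val_zCoord_add_le hP.1 hQ.1) n
    _ < t := by
        rcases le_total (w P.zCoord) (w Q.zCoord) with h | h
        · rw [max_eq_right h]; exact hQ.2
        · rw [max_eq_left h]; exact hP.2

/-- **First-order torsion estimate** (AEC VII.3.1 / IV.6.1, weak form, any valued field): if
`Q ∈ E₁` is killed by `m`, then `Q = O` or `|m| ≤ |z(Q)|` — from `|z(m·Q) − m z(Q)| ≤ |z(Q)|²`
(`val_zCoord_nsmul_sub_le`) with `z(m·Q) = z(O) = 0`.
[cite: SilvermanAEC2009, Prop. IV.2.3 with Prop. VII.2.2 and VII.3.1] -/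
theorem val_le_val_zCoord_of_smul_eq_zero {Q : V.toAffine.Point} (hQ : Q ∈ kernel w V) {m : ℕ}
    (hm : m • Q = 0) : Q = 0 ∨ w (m : F) ≤ w Q.zCoord := by
  by_cases hQ0 : Q = 0
  · exact Or.inl hQ0
  right
  have h := val_zCoord_nsmul_sub_le hQ m
  rw [hm, WeierstrassCurve.Affine.Point.zCoord_zero, zero_sub, Valuation.map_neg, map_mul, pow_two]
    at h
  have hz0 : w Q.zCoord ≠ 0 := fun h0 =>
    hQ0 ((zCoord_eq_zero_iff hQ).mp ((map_eq_zero w).mp h0))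
  exact le_of_mul_le_mul_right h (pos_iff_ne_zero.mpr hz0)

/-- **Contraction of `p`-power multiples in `E₁`**: `|z(pᵏ·Q)| ≤ max(|p|, |z(Q)|)ᵏ · |z(Q)|`
(each multiplication by `p` gains a factor `max(|p|, |z|)`: `|z(p·R)| ≤ max(|p||z(R)|, |z(R)|²)` by
`val_zCoord_nsmul_sub_le`, and `|z(R)| ≤ |z(Q)|` along the way by `val_zCoord_nsmul_le`).
[cite: SilvermanAEC2009, Prop. IV.2.3 and Prop. IV.3.2] -/
theorem val_zCoord_pow_smul_le_mul_pow {Q : V.toAffine.Point} (hQ : Q ∈ kernel w V) (p k : ℕ) :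
    w ((p ^ k) • Q).zCoord ≤ (max (w (p : F)) (w Q.zCoord)) ^ k * w Q.zCoord := by
  induction k with
  | zero => simp
  | succ k ih =>
    set R := (p ^ k) • Q with hR
    have hRmem : R ∈ kernel w V := (kernel w V).nsmul_mem hQ _
    have hRle : w R.zCoord ≤ w Q.zCoord := val_zCoord_nsmul_le hQ _
    -- `|z(p·R)| ≤ max(|p| |z R|, |z R|²) ≤ max(|p|, |z Q|) · |z R|`
    have h1 := val_zCoord_nsmul_sub_le hRmem p
    have hstep : w (p • R).zCoord ≤ max (w (p : F)) (w Q.zCoord) * w R.zCoord := by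
      have e : (p • R).zCoord = ((p • R).zCoord - p * R.zCoord) + p * R.zCoord := by ring
      rw [e]
      refine w.map_add_le ?_ ?_
      · calc w ((p • R).zCoord - p * R.zCoord) ≤ w R.zCoord ^ 2 := h1
          _ = w R.zCoord * w R.zCoord := pow_two _
          _ ≤ max (w (p : F)) (w Q.zCoord) * w R.zCoord :=
              mul_le_mul' (le_max_of_le_right hRle) le_rfl
      · rw [map_mul]
        exact mul_le_mul' (le_max_left _ _) le_rfl
    rw [pow_succ, mul_nsmul]
    calc w (p • R).zCoord ≤ max (w (p : F)) (w Q.zCoord) * w R.zCoord := hstep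
      _ ≤ max (w (p : F)) (w Q.zCoord) * ((max (w (p : F)) (w Q.zCoord)) ^ k * w Q.zCoord) := by
          gcongr
      _ = (max (w (p : F)) (w Q.zCoord)) ^ (k + 1) * w Q.zCoord := by ring

end Generic

/-! ### Number fields: the valuation `‖σ ·‖` of `H` at an embedding `σ : H → ℂ_p` -/

section Embedding

open FormalGroupChart Literature.NumberTheory.NumberFields

variable (W : WeierstrassCurve ℚ) [hW : W.IsIntegral ℤ] {p : ℕ} [Fact p.Prime]
  (H : Type) [Field H] [NumberField H]

omit hW [NumberField H] in
/-- `(‖·‖ ∘ σ)(a) = ‖σ a‖₊` for the pulled-back valuation of an embedding `σ : H → ℂ_p`. [folklore] -/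
private theorem valuationComap_apply (σ : H →+* ℂ_[p]) (a : H) :
    (NormedField.valuation.comap σ : Valuation H ℝ≥0) a = ‖σ a‖₊ := rfl

omit hW [NumberField H] in
/-- `1 < (‖·‖ ∘ σ)(a) ↔ 1 < ‖σ a‖`. [folklore] -/
private theorem one_lt_valuationComap_iff (σ : H →+* ℂ_[p]) (a : H) :
    1 < (NormedField.valuation.comap σ : Valuation H ℝ≥0) a ↔ 1 < ‖σ a‖ := by
  rw [valuationComap_apply, ← NNReal.coe_lt_coe, NNReal.coe_one, coe_nnnorm]

omit hW [NumberField H] in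
/-- `(‖·‖ ∘ σ)(a) ^ n < (‖·‖ ∘ σ)(p) ↔ ‖σ a‖ ^ n < p⁻¹`. [folklore] -/
private theorem valuationComap_pow_lt_iff (σ : H →+* ℂ_[p]) (a : H) (n : ℕ) :
    (NormedField.valuation.comap σ : Valuation H ℝ≥0) a ^ n <
        (NormedField.valuation.comap σ : Valuation H ℝ≥0) (p : H) ↔
      ‖σ a‖ ^ n < (p : ℝ)⁻¹ := by
  rw [valuationComap_apply, valuationComap_apply, ← NNReal.coe_lt_coe, NNReal.coe_pow, coe_nnnorm,
    coe_nnnorm, norm_embedding_natCast_prime (p := p) σ]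

/-- **`W ⊗ H` is integral for the valuation ring of `‖σ ·‖`** (its coefficients are rational integers,
of norm `≤ 1` under `σ`). [cite: NeukirchANT1999, Ch. II (8.2)] -/
theorem isIntegral_integer_valuationComap (σ : H →+* ℂ_[p]) :
    (W.baseChange H).IsIntegral (NormedField.valuation.comap σ : Valuation H ℝ≥0).integer := by
  have hw : ∀ m : ℤ, (NormedField.valuation.comap σ : Valuation H ℝ≥0) (m : H) ≤ 1 := fun m => by
    rw [valuationComap_apply, ← NNReal.coe_le_coe, NNReal.coe_one, coe_nnnorm,
      show (m : H) = ((m : 𝓞 H) : H) by simp]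
    exact norm_embedding_le_one_of_mem_ringOfIntegers (p := p) σ _
  have hc := valuation_coeff_baseChange_le_one W H (NormedField.valuation.comap σ : Valuation H ℝ≥0) hw
  exact ⟨⟨⟨(W.baseChange H).a₁, hc.1⟩, ⟨(W.baseChange H).a₂, hc.2.1⟩, ⟨(W.baseChange H).a₃, hc.2.2.1⟩,
    ⟨(W.baseChange H).a₄, hc.2.2.2.1⟩, ⟨(W.baseChange H).a₆, hc.2.2.2.2⟩⟩, rfl⟩

variable {W H} in
/-- **The disc subgroups at ONE embedding `σ : H → ℂ_p`.** There are subgroups `T ≤ S` of `E(H)`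
with: `(x, y) ∈ S ↔ ‖σ x‖ > 1 ∧ ‖σ(−x/y)‖^{p−1} < p⁻¹` (kernel of reduction + sigma disc at `σ`),
`(x, y) ∈ T ↔ ‖σ x‖ > 1 ∧ ‖σ(−x/y)‖ < p⁻¹` (first-order disc); `T` is TORSION-FREE (first-order
torsion estimate: a prime-order-`q` point of `E₁` has `‖q‖ ≤ ‖z‖`); every point of `S` has all its
large `p`-power multiples in `T` (contraction `‖z(pᵏQ)‖ ≤ max(‖p‖, ‖z(Q)‖)ᵏ‖z(Q)‖`).
[cite: SilvermanAEC2009, VII.2.2, VII.3.1 and Prop. IV.3.2] [cite: SteinWuthrich2013, §4] -/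
theorem exists_addSubgroups_embDisc (σ : H →+* ℂ_[p]) :
    ∃ S T : AddSubgroup (W.baseChange H).toAffine.Point,
      T ≤ S ∧
      (∀ {x y : H} (h : (W.baseChange H).toAffine.Nonsingular x y),
        (.some x y h : (W.baseChange H).toAffine.Point) ∈ S ↔
          1 < ‖σ x‖ ∧ ‖σ (-x / y)‖ ^ (p - 1) < (p : ℝ)⁻¹) ∧
      (∀ {x y : H} (h : (W.baseChange H).toAffine.Nonsingular x y),
        (.some x y h : (W.baseChange H).toAffine.Point) ∈ T ↔
          1 < ‖σ x‖ ∧ ‖σ (-x / y)‖ < (p : ℝ)⁻¹) ∧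
      (∀ P ∈ T, IsOfFinAddOrder P → P = 0) ∧
      (∀ P ∈ S, ∃ k : ℕ, ∀ j : ℕ, k ≤ j → (p ^ j) • P ∈ T) := by
  haveI := isIntegral_integer_valuationComap W H σ
  have hp : p.Prime := Fact.out
  set w : Valuation H ℝ≥0 := NormedField.valuation.comap σ with hwdef
  have hp1 : p - 1 ≠ 0 := by have := hp.two_le; omega
  have hwp : 0 < w (p : H) := by
    rw [Valuation.pos_iff]; exact_mod_cast hp.ne_zero
  obtain ⟨S, hS⟩ := exists_addSubgroup_strictLevelPow w (W.baseChange H) hp1 hwp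
  obtain ⟨T, hT⟩ := exists_addSubgroup_strictLevelPow w (W.baseChange H) one_ne_zero hwp
  -- affine membership
  have hSmem : ∀ {x y : H} (h : (W.baseChange H).toAffine.Nonsingular x y),
      (.some x y h : (W.baseChange H).toAffine.Point) ∈ S ↔
        1 < ‖σ x‖ ∧ ‖σ (-x / y)‖ ^ (p - 1) < (p : ℝ)⁻¹ := fun h => by
    rw [hS, some_mem_kernel_iff h, one_lt_valuationComap_iff, WeierstrassCurve.Affine.Point.zCoord_some,
      valuationComap_pow_lt_iff]
  have hTmem : ∀ {x y : H} (h : (W.baseChange H).toAffine.Nonsingular x y),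
      (.some x y h : (W.baseChange H).toAffine.Point) ∈ T ↔
        1 < ‖σ x‖ ∧ ‖σ (-x / y)‖ < (p : ℝ)⁻¹ := fun h => by
    rw [hT, some_mem_kernel_iff h, one_lt_valuationComap_iff, WeierstrassCurve.Affine.Point.zCoord_some,
      valuationComap_pow_lt_iff, pow_one]
  refine ⟨S, T, fun P hP => ?_, hSmem, hTmem, ?_, ?_⟩
  · -- `T ≤ S`: `|z| < |p| ≤ 1` gives `|z|^{p-1} ≤ |z| < |p|`
    rw [hT] at hP
    rw [hS]
    have hz : w P.zCoord < w (p : H) := by simpa using hP.2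
    exact ⟨hP.1, lt_of_le_of_lt
      (pow_le_of_le_one zero_le (hz.le.trans (val_natCast_le_one w p)) hp1) hz⟩
  · -- `T` is torsion-free
    intro P hP hfin
    by_contra hP0
    have hN : 0 < addOrderOf P := hfin.addOrderOf_pos
    have hN1 : addOrderOf P ≠ 1 := by rwa [Ne, AddMonoid.addOrderOf_eq_one_iff]
    obtain ⟨q, hq, hqN⟩ := Nat.exists_prime_and_dvd hN1
    obtain ⟨m, hm⟩ := hqN
    have hm0 : m ≠ 0 := by rintro rfl; rw [mul_zero] at hm; omega
    have hmlt : m < addOrderOf P := by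
      rw [hm]; exact lt_mul_left (Nat.pos_of_ne_zero hm0) hq.one_lt
    have hRmem : m • P ∈ T := T.nsmul_mem hP m
    have hR0 : m • P ≠ 0 := nsmul_ne_zero_of_lt_addOrderOf hm0 hmlt
    have hqR : q • (m • P) = 0 := by
      rw [← mul_nsmul, Nat.mul_comm m q, ← hm]; exact addOrderOf_nsmul_eq_zero P
    rw [hT] at hRmem
    rcases val_le_val_zCoord_of_smul_eq_zero hRmem.1 hqR with h0 | hle
    · exact hR0 h0
    by_cases hqp : q = p
    · subst hqp
      have := hRmem.2
      rw [pow_one] at this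
      exact (not_lt.mpr hle) this
    · have hq1 : w (q : H) = 1 := by
        rw [hwdef, valuationComap_apply, ← NNReal.coe_eq_one, coe_nnnorm]
        exact norm_embedding_natCast_eq_one_of_not_dvd (p := p) σ
          (fun hdvd => hqp ((Nat.prime_dvd_prime_iff_eq hp hq).mp hdvd).symm)
      rw [hq1] at hle
      exact (not_lt.mpr hle) (val_zCoord_lt_one hRmem.1)
  · -- contraction into `T`
    intro P hP
    rw [hS] at hP
    set μ : ℝ≥0 := max (w (p : H)) (w P.zCoord) with hμ
    have hμ1 : μ < 1 := max_lt (by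
      rw [hwdef, valuationComap_apply, ← NNReal.coe_lt_one, coe_nnnorm, norm_embedding_natCast_prime (p := p) σ]
      exact inv_lt_one_of_one_lt₀ (by exact_mod_cast hp.one_lt)) (val_zCoord_lt_one hP.1)
    obtain ⟨k, hk⟩ := exists_pow_lt_of_lt_one (NNReal.coe_pos.mpr hwp) (NNReal.coe_lt_one.mpr hμ1)
    refine ⟨k, fun j hj => ?_⟩
    rw [hT]
    refine ⟨(kernel w (W.baseChange H)).nsmul_mem hP.1 _, ?_⟩
    rw [pow_one]
    calc w ((p ^ j) • P).zCoord ≤ μ ^ j * w P.zCoord := val_zCoord_pow_smul_le_mul_pow hP.1 p j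
      _ ≤ μ ^ j * 1 := mul_le_mul' le_rfl (val_zCoord_lt_one hP.1).le
      _ ≤ μ ^ k := by rw [mul_one]; exact pow_le_pow_right_of_le_one' hμ1.le hj
      _ < w (p : H) := by exact_mod_cast hk

end Embedding

/-! ### The two subgroups of `E(H)` -/

section Main

open FormalGroupChart Literature.NumberTheory.NumberFields

variable (W : WeierstrassCurve ℚ) [hW : W.IsIntegral ℤ] (p : ℕ) [Fact p.Prime]
  (H : Type) [Field H] [NumberField H]

/-- **The disc subgroup `A` and its torsion-free core `G` of `E(H)`, any prime `p`.** For `W/ℚ` with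
integer coefficients, a prime `p` and a number field `H` there are subgroups `G ≤ A ≤ E(H)` such that:
(i) `G` is TORSION-FREE; (ii) every point satisfying the cyclotomic local conditions
`SatisfiesLocalConditionsCyc p` (at each `w ∋ p`: `ord_w x < 0` and `ord_w(z^{p−1}) > ord_w p`;
non-singular reduction at every finite place) lies in `A`; (iii) affine members `(x, y)` of `A` have
`‖σ x‖ > 1` under every embedding `σ : H → ℂ_p` and non-singular reduction everywhere; (iv) every
`P ∈ A` has a multiple `pᵏ·P ∈ G`; (v) `A` is stable under `Aut(H/ℚ)` (`pointGalHom`).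
(`A = ⨅_σ {‖σx‖ > 1, ‖σz‖^{p−1} < ‖p‖} ⊓ ⨅_v E₀(v)`, `G` = the same with `‖σz‖ < ‖p‖`;
`exists_addSubgroups_embDisc` at each `σ`, the bridge `PrimesAbovePEmbeddingNormProofs` for (ii).)
[cite: MazurSteinTate2006, §2.6–2.7 (PDF p. 10 L7 – p. 11 L6)] [cite: SilvermanAEC2009, VII.2.2 and VII.3.1]
[cite: SteinWuthrich2013, §4] [cite: NeukirchANT1999, Ch. II (8.1)–(8.2)] -/
theorem exists_addSubgroups_cycLocus :
    ∃ A G : AddSubgroup (W.baseChange H).toAffine.Point,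
      G ≤ A ∧
      (∀ P ∈ G, IsOfFinAddOrder P → P = 0) ∧
      (∀ P, W.SatisfiesLocalConditionsCyc p H P → P ∈ A) ∧
      (∀ {x y : H} (h : (W.baseChange H).toAffine.Nonsingular x y),
        (.some x y h : (W.baseChange H).toAffine.Point) ∈ A →
          (∀ σ : H →ₐ[ℚ] ℂ_[p], 1 < ‖σ x‖) ∧
            ∀ v : HeightOneSpectrum (𝓞 H), W.HasNonsingularReductionAtK H v x y) ∧
      (∀ P ∈ A, ∃ k : ℕ, (p ^ k) • P ∈ G) ∧
      (∀ (τ : H ≃ₐ[ℚ] H) (P : (W.baseChange H).toAffine.Point), P ∈ A → pointGalHom W H τ P ∈ A) := by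
  choose S T hTS hSmem hTmem hTtf hcontr using
    fun σ : H →ₐ[ℚ] ℂ_[p] => exists_addSubgroups_embDisc (W := W) (H := H) (σ : H →+* ℂ_[p])
  set E₀ : AddSubgroup (W.baseChange H).toAffine.Point :=
    ⨅ v : HeightOneSpectrum (𝓞 H), nonsingularReductionSubgroupAtPlace W H v with hE₀
  refine ⟨(⨅ σ, S σ) ⊓ E₀, (⨅ σ, T σ) ⊓ E₀, inf_le_inf_right _ (iInf_mono fun σ => hTS σ),
    ?_, ?_, ?_, ?_, ?_⟩
  · -- (i) torsion-free: read at one embedding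
    intro P hP hfin
    haveI : Nonempty (H →ₐ[ℚ] ℂ_[p]) := by
      have : 0 < Fintype.card (H →ₐ[ℚ] ℂ_[p]) := by
        rw [AlgHom.card ℚ H ℂ_[p]]; exact Module.finrank_pos
      exact Fintype.card_pos_iff.mp this
    obtain ⟨σ₀⟩ := (inferInstance : Nonempty (H →ₐ[ℚ] ℂ_[p]))
    exact hTtf σ₀ P (AddSubgroup.mem_iInf.mp (AddSubgroup.mem_inf.mp hP).1 σ₀) hfin
  · -- (ii) the admissible locus lies in `A`
    intro P hP
    rcases P with _ | ⟨x, y, h⟩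
    · exact hP.elim
    obtain ⟨hloc, hns⟩ := hP
    refine AddSubgroup.mem_inf.mpr ⟨AddSubgroup.mem_iInf.mpr fun σ => (hSmem σ h).mpr ⟨?_, ?_⟩,
      AddSubgroup.mem_iInf.mpr fun v => (some_mem_nonsingularReductionSubgroupAtPlace_iff v h).mpr (hns v)⟩
    · exact one_lt_norm_embedding_of_forall_one_lt_valuation (p := p) (σ : H →+* ℂ_[p])
        fun w hw => (hloc w hw).1
    · exact norm_embedding_pow_lt_of_forall_valuation_pow_lt (p := p) (σ : H →+* ℂ_[p])
        fun w hw => (hloc w hw).2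
  · -- (iii) facts for affine members
    intro x y h hP
    obtain ⟨hS', hE⟩ := AddSubgroup.mem_inf.mp hP
    exact ⟨fun σ => ((hSmem σ h).mp (AddSubgroup.mem_iInf.mp hS' σ)).1, fun v =>
      (some_mem_nonsingularReductionSubgroupAtPlace_iff v h).mp (AddSubgroup.mem_iInf.mp hE v)⟩
  · -- (iv) contraction into `G`
    intro P hP
    obtain ⟨hS', hE⟩ := AddSubgroup.mem_inf.mp hP
    choose k hk using fun σ => hcontr σ P (AddSubgroup.mem_iInf.mp hS' σ)
    exact ⟨Finset.univ.sup k, AddSubgroup.mem_inf.mpr ⟨AddSubgroup.mem_iInf.mpr fun σ =>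
      hk σ _ (Finset.le_sup (Finset.mem_univ σ)), E₀.nsmul_mem hE _⟩⟩
  · -- (v) `Aut(H/ℚ)`-stability
    intro τ P hP
    rcases P with _ | ⟨x, y, h⟩
    · rw [← WeierstrassCurve.Affine.Point.zero_def, map_zero]; exact AddSubgroup.zero_mem _
    obtain ⟨hS', hE⟩ := AddSubgroup.mem_inf.mp hP
    rw [pointGalHom_apply, WeierstrassCurve.Affine.Point.map_some]
    refine AddSubgroup.mem_inf.mpr ⟨AddSubgroup.mem_iInf.mpr fun σ => ?_,
      AddSubgroup.mem_iInf.mpr fun v => ?_⟩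
    · have hmem := (hSmem (σ.comp (τ : H →ₐ[ℚ] H)) h).mp (AddSubgroup.mem_iInf.mp hS' _)
      refine (hSmem σ _).mpr ⟨hmem.1, ?_⟩
      have e : -((τ : H →ₐ[ℚ] H) x) / (τ : H →ₐ[ℚ] H) y = (τ : H →ₐ[ℚ] H) (-x / y) := by
        rw [map_div₀, map_neg]
      rw [e]
      exact hmem.2
    · exact (some_mem_nonsingularReductionSubgroupAtPlace_iff v _).mpr
        ((hasNonsingularReductionAtK_algEquiv_iff τ v x y).mpr
          ((some_mem_nonsingularReductionSubgroupAtPlace_iff _ h).mp (AddSubgroup.mem_iInf.mp hE _)))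

end Main

end Literature.NumberTheory.EllipticCurves

end
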